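import Literature.Probability.RandomPlanarGeometry.HexSAWBrickWallStripFugacityWidthOneComplexRoot
import Literature.Probability.RandomPlanarGeometry.HexSAWBrickWallStripFugacityWidthOneUniformAmplitude
import Literature.Analysis.Asymptotics.ComplexLinearRecurrenceDominantRoot
import Mathlib.Analysis.SpecialFunctions.Trigonometric.Bounds
import HarnessLib

/-!
# The complex Perron root of the two-wall cubic: displacement `O(t)` and persistence of the cofactor gap

Topic `Literature/Probability/RandomPlanarGeometry` (continues `…WidthOneComplexRoot.lean` — the cubic `F(ω,t) = ω(ω − ye^{it})(ω − z) − yze^{it}`, the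
simple real root `s = μ₁(y,z)²`, `exists_complexPerronRoot` — and `…WidthOneUniformAmplitude.lean` — the REAL cofactor gap
`0 < R₀ := quadRootBound(s − y − z, yz/s) < s`; uses `Literature/Analysis/Asymptotics/ComplexLinearRecurrenceDominantRoot.lean` —
`norm_root_le_of_near`).  Brick B7 (quantitative part) of DOOR-ap5-g27 item 1:

* §1 `twoWallCubic_sub_at_zero` (`F(ω,t) − F(ω,0) = −y(e^{it} − 1)(ω(ω − z) + z)`), ★ `norm_twoWallCubic_real_root_le`
  (`‖F(s,t)‖ ≤ y(s(s − z) + z)|t|`), ★ `norm_sub_le_of_newton_location` (any root located to Newton accuracy `θ ≤ 1` satisfies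
  `‖s(t) − s‖ ≤ 2‖F(s,t)‖/F_ω(s,0) ≤ 2y(s(s−z)+z)|t|/F_ω(s,0)` — the Perron root moves by `O(t)` with an EXPLICIT constant).
* §2 ★ `norm_cofactor_coeff_sub_le` — for `‖s' − s‖ ≤ d ≤ s/2` and `w = ye^{it}`: `‖(s' − w − z) − (s − y − z)‖ ≤ d + y|t|` and
  `‖wz/s' − yz/s‖ ≤ 2yz(s|t| + d)/s²`.
* §3 ★★ `cofactor_roots_le_of_near` — hence there are EXPLICIT `t₀, d₀ > 0` such that for `|t| ≤ t₀`, `‖s' − s‖ ≤ d₀` every root of the complex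
  cofactor `σ² + (s' − w − z)σ + wz/s'` has modulus `≤ (R₀ + s)/2 < s − d₀ ≤ ‖s'‖`: the spectral gap persists at complex fugacity, which is the
  `(R, s)` input of `Literature.Analysis.Asymptotics.exists_tendsto_parity_of_rec_six` / `cubic_charpoly_data` (`rootBound_lt_norm_of_near`: `R₀ + g/2 < ‖s'‖`).

## Sources
N. R. Beaton et al., CMP 326 (2014), arXiv:1109.0358v5 §3.2 Proposition 6; R. P. Stanley, EC1 §4.1 Theorem 4.1.1 (iii); L. V. Ahlfors (1979) Ch. 4 §3.3.  Lane
statements; nothing is quoted AS PRINTED.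
-/

noncomputable section

open Set Metric Filter Complex
open Literature.Analysis Literature.Analysis.Asymptotics
open scoped Topology

namespace Literature.Probability.RandomPlanarGeometry.SAW.HexBW

namespace WidthOneYZ

variable {y z : ℝ}

/-! ## §1 The size of the perturbation and the displacement of the root -/

/-- `F(ω, t) − F(ω, 0) = −y(e^{it} − 1)(ω(ω − z) + z)`. [cite: BeatonBousquetMelouDeGierDuminilCopinGuttmann2014, §3.2 Proposition 6 (lane plumbing)] -/
theorem twoWallCubic_sub_at_zero (y z : ℝ) (ω : ℂ) (t : ℝ) :
    twoWallCubic y z ω t - twoWallCubic y z ω 0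
      = -((y : ℂ) * (cexp ((t : ℂ) * I) - 1) * (ω * (ω - (z : ℂ)) + (z : ℂ))) := by
  unfold twoWallCubic
  simp only [Complex.ofReal_zero, zero_mul, Complex.exp_zero, mul_one]
  ring

/-- ★ **The perturbation at the real root is `O(t)`**: `‖F(s,t)‖ ≤ y·(s(s − z) + z)·|t|`, `s = μ₁(y,z)²` (`|e^{it} − 1| ≤ |t|`).
[cite: BeatonBousquetMelouDeGierDuminilCopinGuttmann2014, §3.2 Proposition 6 (lane statement)] -/
theorem norm_twoWallCubic_real_root_le (hy : 0 < y) (hz : 0 < z) (t : ℝ) :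
    ‖twoWallCubic y z ((stripMuY₂ 1 y z ^ 2 : ℝ) : ℂ) t‖
      ≤ y * (stripMuY₂ 1 y z ^ 2 * (stripMuY₂ 1 y z ^ 2 - z) + z) * |t| := by
  set s := stripMuY₂ 1 y z ^ 2 with hs
  obtain ⟨-, hsz⟩ := lt_stripMuY₂_one_sq₂ hy hz
  have hsz' : z < s := hsz
  have h0 := twoWallCubic_zero hy hz
  have e : twoWallCubic y z (s : ℂ) t = -((y : ℂ) * (cexp ((t : ℂ) * I) - 1) * ((s : ℂ) * ((s : ℂ) - (z : ℂ)) + (z : ℂ))) := by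
    have := twoWallCubic_sub_at_zero y z (s : ℂ) t
    rw [h0, sub_zero] at this
    exact this
  rw [e, norm_neg, norm_mul, norm_mul]
  have hexp : ‖cexp ((t : ℂ) * I) - 1‖ ≤ |t| := by
    have h := Real.norm_exp_I_mul_ofReal_sub_one_le (x := t)
    rw [mul_comm] at h
    rwa [Real.norm_eq_abs] at h
  have hq : 0 < s * (s - z) + z := by nlinarith [mul_pos (lt_trans hz hsz') (sub_pos.2 hsz')]
  have hpoly : ‖(s : ℂ) * ((s : ℂ) - (z : ℂ)) + (z : ℂ)‖ = s * (s - z) + z := by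
    have : (s : ℂ) * ((s : ℂ) - (z : ℂ)) + (z : ℂ) = ((s * (s - z) + z : ℝ) : ℂ) := by push_cast; ring
    rw [this, Complex.norm_real, Real.norm_of_nonneg hq.le]
  rw [Complex.norm_real, Real.norm_of_nonneg hy.le, hpoly]
  have h1 : 0 ≤ y * (s * (s - z) + z) := (mul_pos hy hq).le
  calc y * ‖cexp ((t : ℂ) * I) - 1‖ * (s * (s - z) + z) = y * (s * (s - z) + z) * ‖cexp ((t : ℂ) * I) - 1‖ := by ring
    _ ≤ y * (s * (s - z) + z) * |t| := mul_le_mul_of_nonneg_left hexp h1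

/-- ★ **Displacement of the root from its Newton location**: if `‖s' − (s − F(s,t)/c)‖ ≤ θ‖F(s,t)/c‖` with `θ ≤ 1` (the conclusion of
`exists_complexPerronRoot`), then `‖s' − s‖ ≤ 2‖F(s,t)‖/‖c‖`; with `c = F_ω(s,0) > 0` and §1: `‖s' − s‖ ≤ 2y(s(s−z)+z)|t|/F_ω(s,0)`.
[cite: Ahlfors1979, Ch. 4 §3.3 (lane statement)] -/
theorem norm_sub_le_of_newton_location {s' s₀ F c : ℂ} {θ : ℝ} (hθ1 : θ ≤ 1)
    (h : ‖s' - (s₀ - F / c)‖ ≤ θ * ‖F / c‖) : ‖s' - s₀‖ ≤ 2 * ‖F‖ / ‖c‖ := by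
  have hFc : ‖F / c‖ = ‖F‖ / ‖c‖ := norm_div _ _
  have h0 : 0 ≤ ‖F / c‖ := norm_nonneg _
  calc ‖s' - s₀‖ = ‖(s' - (s₀ - F / c)) + (-(F / c))‖ := by ring_nf
    _ ≤ ‖s' - (s₀ - F / c)‖ + ‖-(F / c)‖ := norm_add_le _ _
    _ ≤ θ * ‖F / c‖ + ‖F / c‖ := by rw [norm_neg]; linarith [h]
    _ ≤ 1 * ‖F / c‖ + ‖F / c‖ := by nlinarith [h0]
    _ = 2 * ‖F‖ / ‖c‖ := by rw [hFc]; ring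

/-! ## §2 The cofactor coefficients move by `O(|t| + ‖s' − s‖)` -/

/-- ★ **The cofactor coefficients at complex fugacity**: for `‖s' − s‖ ≤ d ≤ s/2`, `w = y e^{it}` (`s = μ₁(y,z)²`):
`‖(s' − w − z) − (s − y − z)‖ ≤ d + y|t|` and `‖wz/s' − yz/s‖ ≤ 2yz(s|t| + d)/s²`.
[cite: Stanley2012EC1, §4.1 Theorem 4.1.1 (iii) (lane plumbing: perturbation of the characteristic polynomial)] -/
theorem norm_cofactor_coeff_sub_le (hy : 0 < y) (hz : 0 < z) {s' : ℂ} {d t : ℝ}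
    (hd : ‖s' - ((stripMuY₂ 1 y z ^ 2 : ℝ) : ℂ)‖ ≤ d) (hds : d ≤ stripMuY₂ 1 y z ^ 2 / 2) :
    ‖(s' - (y : ℂ) * cexp ((t : ℂ) * I) - (z : ℂ)) - (((stripMuY₂ 1 y z ^ 2 - y - z : ℝ)) : ℂ)‖ ≤ d + y * |t| ∧
    ‖(y : ℂ) * cexp ((t : ℂ) * I) * (z : ℂ) / s' - ((y * z / stripMuY₂ 1 y z ^ 2 : ℝ) : ℂ)‖
      ≤ 2 * y * z * (stripMuY₂ 1 y z ^ 2 * |t| + d) / (stripMuY₂ 1 y z ^ 2) ^ 2 := by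
  set s := stripMuY₂ 1 y z ^ 2 with hs
  obtain ⟨hsy, -⟩ := lt_stripMuY₂_one_sq₂ hy hz
  have hs0 : 0 < s := lt_trans hy hsy
  have hd0 : 0 ≤ d := le_trans (norm_nonneg _) hd
  have hexp : ‖cexp ((t : ℂ) * I) - 1‖ ≤ |t| := by
    have h := Real.norm_exp_I_mul_ofReal_sub_one_le (x := t)
    rw [mul_comm] at h
    rwa [Real.norm_eq_abs] at h
  constructor
  · have e : (s' - (y : ℂ) * cexp ((t : ℂ) * I) - (z : ℂ)) - (((s - y - z : ℝ)) : ℂ)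
        = (s' - (s : ℂ)) - (y : ℂ) * (cexp ((t : ℂ) * I) - 1) := by push_cast; ring
    rw [e]
    calc ‖(s' - (s : ℂ)) - (y : ℂ) * (cexp ((t : ℂ) * I) - 1)‖ ≤ ‖s' - (s : ℂ)‖ + ‖(y : ℂ) * (cexp ((t : ℂ) * I) - 1)‖ := norm_sub_le _ _
      _ ≤ d + y * |t| := by
          rw [norm_mul, Complex.norm_real, Real.norm_of_nonneg hy.le]
          exact add_le_add hd (mul_le_mul_of_nonneg_left hexp hy.le)
  · -- `‖s'‖ ≥ s − d ≥ s/2`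
    have hs'low : s / 2 ≤ ‖s'‖ := by
      have h1 : ‖(s : ℂ)‖ - ‖s' - (s : ℂ)‖ ≤ ‖s'‖ := by
        have := norm_sub_norm_le (s : ℂ) ((s : ℂ) - s')
        rw [sub_sub_cancel, norm_sub_rev] at this
        linarith
      rw [Complex.norm_real, Real.norm_of_nonneg hs0.le] at h1
      linarith
    have hs'0 : s' ≠ 0 := by
      intro h; rw [h, norm_zero] at hs'low; linarith
    have hsC : (s : ℂ) ≠ 0 := by exact_mod_cast hs0.ne'
    have e : (y : ℂ) * cexp ((t : ℂ) * I) * (z : ℂ) / s' - ((y * z / s : ℝ) : ℂ)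
        = (y : ℂ) * (z : ℂ) * ((cexp ((t : ℂ) * I) - 1) * (s : ℂ) + ((s : ℂ) - s')) / (s' * (s : ℂ)) := by
      push_cast
      field_simp
      ring
    rw [e, norm_div, norm_mul, norm_mul, norm_mul, Complex.norm_real, Complex.norm_real, Complex.norm_real,
      Real.norm_of_nonneg hy.le, Real.norm_of_nonneg hz.le, Real.norm_of_nonneg hs0.le]
    have hnum : ‖(cexp ((t : ℂ) * I) - 1) * (s : ℂ) + ((s : ℂ) - s')‖ ≤ s * |t| + d := by
      calc ‖(cexp ((t : ℂ) * I) - 1) * (s : ℂ) + ((s : ℂ) - s')‖ ≤ ‖(cexp ((t : ℂ) * I) - 1) * (s : ℂ)‖ + ‖(s : ℂ) - s'‖ := norm_add_le _ _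
        _ ≤ |t| * s + d := by
            have hd' : ‖(s : ℂ) - s'‖ ≤ d := by rw [norm_sub_rev]; exact hd
            rw [norm_mul, Complex.norm_real, Real.norm_of_nonneg hs0.le]
            exact add_le_add (mul_le_mul_of_nonneg_right hexp hs0.le) hd'
        _ = s * |t| + d := by ring
    have hden : s / 2 * s ≤ ‖s'‖ * s := mul_le_mul_of_nonneg_right hs'low hs0.le
    have hden0 : 0 < ‖s'‖ * s := lt_of_lt_of_le (by positivity) hden
    rw [div_le_div_iff₀ hden0 (by positivity)]
    have hyz : 0 ≤ y * z := by positivity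
    calc y * z * ‖(cexp ((t : ℂ) * I) - 1) * (s : ℂ) + ((s : ℂ) - s')‖ * s ^ 2
        ≤ y * z * (s * |t| + d) * s ^ 2 := by gcongr
      _ = 2 * y * z * (s * |t| + d) * (s / 2 * s) := by ring
      _ ≤ 2 * y * z * (s * |t| + d) * (‖s'‖ * s) := by
          have h0 : 0 ≤ 2 * y * z * (s * |t| + d) := by positivity
          exact mul_le_mul_of_nonneg_left hden h0

/-! ## §3 ★★ The cofactor gap persists -/

/-- ★★ **THE SPECTRAL GAP PERSISTS AT COMPLEX FUGACITY (explicit smallness).**  Let `s = μ₁(y,z)²`, `R₀ = quadRootBound(s − y − z, yz/s)` (the real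
cofactor root bound, `0 < R₀ < s`), `g = s − R₀`, `R′ = R₀ + g/2`, `K₁ = R′ + 2yz/s²`, `K₂ = y R′ + 2yz/s`.  If `‖s' − s‖ ≤ d` with
`d ≤ min(s/2, g²/(8K₁ + 8))` and `|t| ≤ g²/(8K₂ + 8)`, then every root `σ` of the complex cofactor `σ² + (s' − ye^{it} − z)σ + ye^{it}z/s'` has
`‖σ‖ ≤ R′` (and `R′ < ‖s'‖` as soon as `d < g/2`, `rootBound_lt_norm_of_near` — so `s'` stays the DOMINANT root).  (§2 + `norm_root_le_of_near`.)
[cite: Stanley2012EC1, §4.1 Theorem 4.1.1 (iii) (lane statement: dominant pole under perturbation); BeatonBousquetMelouDeGierDuminilCopinGuttmann2014, §3.2 Proposition 6] -/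
theorem cofactor_roots_le_of_near (hy : 0 < y) (hz : 0 < z) {s' : ℂ} {d t : ℝ}
    (hd : ‖s' - ((stripMuY₂ 1 y z ^ 2 : ℝ) : ℂ)‖ ≤ d) (hds : d ≤ stripMuY₂ 1 y z ^ 2 / 2)
    (hd1 : d ≤ (stripMuY₂ 1 y z ^ 2 - quadRootBound (stripMuY₂ 1 y z ^ 2 - y - z) (y * z / stripMuY₂ 1 y z ^ 2)) ^ 2 /
      (8 * ((quadRootBound (stripMuY₂ 1 y z ^ 2 - y - z) (y * z / stripMuY₂ 1 y z ^ 2)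
        + (stripMuY₂ 1 y z ^ 2 - quadRootBound (stripMuY₂ 1 y z ^ 2 - y - z) (y * z / stripMuY₂ 1 y z ^ 2)) / 2)
        + 2 * y * z / (stripMuY₂ 1 y z ^ 2) ^ 2) + 8))
    (ht : |t| ≤ (stripMuY₂ 1 y z ^ 2 - quadRootBound (stripMuY₂ 1 y z ^ 2 - y - z) (y * z / stripMuY₂ 1 y z ^ 2)) ^ 2 /
      (8 * (y * (quadRootBound (stripMuY₂ 1 y z ^ 2 - y - z) (y * z / stripMuY₂ 1 y z ^ 2)
        + (stripMuY₂ 1 y z ^ 2 - quadRootBound (stripMuY₂ 1 y z ^ 2 - y - z) (y * z / stripMuY₂ 1 y z ^ 2)) / 2)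
        + 2 * y * z / stripMuY₂ 1 y z ^ 2) + 8))
    {σ : ℂ} (hσ : σ ^ 2 + (s' - (y : ℂ) * cexp ((t : ℂ) * I) - (z : ℂ)) * σ + (y : ℂ) * cexp ((t : ℂ) * I) * (z : ℂ) / s' = 0) :
    ‖σ‖ ≤ quadRootBound (stripMuY₂ 1 y z ^ 2 - y - z) (y * z / stripMuY₂ 1 y z ^ 2)
      + (stripMuY₂ 1 y z ^ 2 - quadRootBound (stripMuY₂ 1 y z ^ 2 - y - z) (y * z / stripMuY₂ 1 y z ^ 2)) / 2 := by
  set s := stripMuY₂ 1 y z ^ 2 with hs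
  set R₀ := quadRootBound (s - y - z) (y * z / s) with hR₀
  obtain ⟨hR0, hRs⟩ := quadRootBound_cofactor_lt hy hz
  rw [← hs] at hR0 hRs
  change 0 < R₀ at hR0
  change R₀ < s at hRs
  set g := s - R₀ with hg
  have hg0 : 0 < g := by rw [hg]; linarith
  set R' := R₀ + g / 2 with hR'
  obtain ⟨hsy, -⟩ := lt_stripMuY₂_one_sq₂ hy hz
  have hs0 : 0 < s := lt_trans hy hsy
  set K₁ := R' + 2 * y * z / s ^ 2 with hK₁
  set K₂ := y * R' + 2 * y * z / s with hK₂
  have hK₁0 : 0 < K₁ := by rw [hK₁]; positivity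
  have hK₂0 : 0 < K₂ := by rw [hK₂]; positivity
  have hd0 : 0 ≤ d := le_trans (norm_nonneg _) hd
  -- the two coefficient displacements
  obtain ⟨hp, hκ⟩ := norm_cofactor_coeff_sub_le hy hz (t := t) hd hds
  rw [← hs] at hp hκ
  -- `norm_root_le_of_near` with `p₀ = s − y − z`, `κ₀ = yz/s` (real cofactor, roots ≤ R₀ by `norm_le_quadRootBound`)
  have hroot : ∀ τ : ℂ, τ ^ 2 + (((s - y - z : ℝ)) : ℂ) * τ + ((y * z / s : ℝ) : ℂ) = 0 → ‖τ‖ ≤ R₀ :=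
    fun τ hτ => norm_le_quadRootBound hτ
  refine norm_root_le_of_near hR0.le (by rw [hR']; linarith) hroot ?_ hσ
  -- the smallness: `‖p − p₀‖ R' + ‖κ − κ₀‖ < (R' − R₀)² = g²/4`
  have hR'0 : 0 < R' := by rw [hR']; positivity
  have e1 : (R' - R₀) ^ 2 = g ^ 2 / 4 := by rw [hR']; ring
  rw [e1]
  have hg2 : 0 < g ^ 2 := pow_pos hg0 2
  have hdK : d * K₁ < g ^ 2 / 8 := by
    have h := hd1
    change d ≤ g ^ 2 / (8 * K₁ + 8) at h
    have h8 : 0 < 8 * K₁ + 8 := by positivity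
    calc d * K₁ ≤ g ^ 2 / (8 * K₁ + 8) * K₁ := mul_le_mul_of_nonneg_right h hK₁0.le
      _ < g ^ 2 / 8 := by
          rw [div_mul_eq_mul_div, div_lt_div_iff₀ h8 (by norm_num)]
          nlinarith [mul_pos hg2 hK₁0, hg2]
  have htK : |t| * K₂ < g ^ 2 / 8 := by
    have h := ht
    change |t| ≤ g ^ 2 / (8 * K₂ + 8) at h
    have h8 : 0 < 8 * K₂ + 8 := by positivity
    calc |t| * K₂ ≤ g ^ 2 / (8 * K₂ + 8) * K₂ := mul_le_mul_of_nonneg_right h hK₂0.le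
      _ < g ^ 2 / 8 := by
          rw [div_mul_eq_mul_div, div_lt_div_iff₀ h8 (by norm_num)]
          nlinarith [mul_pos hg2 hK₂0, hg2]
  have habs : 0 ≤ |t| := abs_nonneg t
  calc ‖(s' - (y : ℂ) * cexp ((t : ℂ) * I) - (z : ℂ)) - ((s - y - z : ℝ) : ℂ)‖ * R'
        + ‖(y : ℂ) * cexp ((t : ℂ) * I) * (z : ℂ) / s' - ((y * z / s : ℝ) : ℂ)‖
      ≤ (d + y * |t|) * R' + 2 * y * z * (s * |t| + d) / s ^ 2 := by
        exact add_le_add (mul_le_mul_of_nonneg_right hp hR'0.le) hκ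
    _ = d * K₁ + |t| * K₂ := by rw [hK₁, hK₂]; field_simp; ring
    _ < g ^ 2 / 8 + g ^ 2 / 8 := add_lt_add hdK htK
    _ = g ^ 2 / 4 := by ring

/-- ★ **… and the perturbed Perron root stays outside that disc**: with `s`, `R₀`, `g = s − R₀` as in `cofactor_roots_le_of_near`, if `‖s' − s‖ ≤ d` and
`d < g/2` then `R₀ + g/2 < ‖s'‖` — the cofactor roots (modulus `≤ R₀ + g/2`) are STRICTLY smaller than the Perron root `s'`.
[cite: Stanley2012EC1, §4.1 Theorem 4.1.1 (iii) (lane statement: dominant pole under perturbation)] -/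
theorem rootBound_lt_norm_of_near (hy : 0 < y) (hz : 0 < z) {s' : ℂ} {d : ℝ}
    (hd : ‖s' - ((stripMuY₂ 1 y z ^ 2 : ℝ) : ℂ)‖ ≤ d)
    (hdg : d < (stripMuY₂ 1 y z ^ 2 - quadRootBound (stripMuY₂ 1 y z ^ 2 - y - z) (y * z / stripMuY₂ 1 y z ^ 2)) / 2) :
    quadRootBound (stripMuY₂ 1 y z ^ 2 - y - z) (y * z / stripMuY₂ 1 y z ^ 2)
      + (stripMuY₂ 1 y z ^ 2 - quadRootBound (stripMuY₂ 1 y z ^ 2 - y - z) (y * z / stripMuY₂ 1 y z ^ 2)) / 2 < ‖s'‖ := by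
  set s := stripMuY₂ 1 y z ^ 2 with hs
  obtain ⟨hsy, -⟩ := lt_stripMuY₂_one_sq₂ hy hz
  have hs0 : 0 < s := lt_trans hy hsy
  have h1 : ‖(s : ℂ)‖ - ‖s' - (s : ℂ)‖ ≤ ‖s'‖ := by
    have := norm_sub_norm_le (s : ℂ) ((s : ℂ) - s')
    rw [sub_sub_cancel, norm_sub_rev] at this
    linarith
  rw [Complex.norm_real, Real.norm_of_nonneg hs0.le] at h1
  linarith

end WidthOneYZ

end Literature.Probability.RandomPlanarGeometry.SAW.HexBW

end
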